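import Mathlib
import HarnessLib
import Summits.NavierStokesRegularity.NavierStokesRegularity.Theorems.PoloidalWindowDoorPoloidalWindowRigidityKillingJetCompactness
import Summits.NavierStokesRegularity.NavierStokesRegularity.Theorems.LocalTiltingFreeDoorSymmetricGerms
import Summits.NavierStokesRegularity.NavierStokesRegularity.Theorems.PlaneEnergyCeilingSlabEnergyIdentityPointwise

/-!
# nsreg-p1 ROUND-18 door S19 «LocalTiltingFreeDoor» — the hard stub TSG made CENSUS-READY: TSG, K2 and the door FROM
# POINTWISE ALL-ORDERS KILLING JETS at a dense set of points (the statement a jet certificate delivers)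

Door S19 (nsreg-p1 g16, DESIGN-ONLY), LINE 2 v3 = line of record: K2 `TiltingFreeProfileRigidity` ⟸ the single OPEN stub
`stub_tiltingSymmetryGerm` («TSG»: a tilting-free door-class profile has, on every slice and inside every window where
`curl v(s) ≠ 0`, a sub-window carrying an infinitesimal Euclidean Killing symmetry of the vorticity or an unbounded entire
extension), everything else a tree theorem (`…LocalTiltingFreeDoorSymmetricGerms`).  The planner's first move on TSG is a jet
CENSUS (ROUND-18 §4 Day 2, Addendum B.3): prolong NS ∧ {ω × Sω = 0} at a generic tilting-free jet and decide whether every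
admissible vorticity jet is infinitesimally Killing-symmetric ORDER BY ORDER — the Killing field may depend on the order.
This file is the S19 twin of the Poloidal door's `…KillingJetCompactness` / `…LrcModEntireOfJets` (stmt-20428): it turns
the order-by-order, point-by-point statement into TSG, with no reference to the truncation order.

* `killingGerm_of_killing_jets` — ONE POINT, class-free: `ω` real-analytic near `y₀`; if for every `N` some Killing field
  `K = a × y + b ≢ 0` has `Dⁿ(L_K ω)(y₀) = 0` for `n ≤ N` (`L_K ω = Dω[K] − a × ω`), then ONE such `K` has `L_K ω = 0` on a
  neighbourhood of `y₀` (the Euclidean algebra `𝔢(3) ≅ ℝ³ ⊕ ℝ³` is a LINEAR 6-parameter family, so ns-poloidal-K2-p3's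
  abstract compactness `exists_combination_eventuallyEq_zero` applies: stable kernel of the jet maps + vanishing Taylor
  series);
* `tsgWindow_of_pointwise` — ONE SLICE: if the points carrying all-orders Killing jets OR an unbounded entire germ of `v(s)`
  are DENSE in `{curl v(s) ≠ 0}` (one such point in every window), the TSG conclusion holds on that slice (Killing
  alternative with `c = 0`);
* `tiltingSymmetryGerm_of_pointwiseKillingJets` — **TSG (text verbatim) ⟸ its pointwise-dense jet form** quantified over
  the class; `tiltingFreeProfileRigidity_of_pointwiseKillingJets`, `target_of_pointwiseKillingJets` — hence K2 and the
  door `Target` (texts of `r18/Sketch19.lean`, verbatim) from that statement alone.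

Seat nsreg-p6 g10 (THEOREMS-ONLY door sequels, DIRECTOR-NS g8 #32 (2)/#36).  WHAT THIS IS NOT: not NS regularity; not TSG
and not a census — the pointwise jet statement is the TARGET a certificate attacks (spelled out as a hypothesis; nothing here
assumes it); no route is opened.
-/

noncomputable section

-- the summit and its single sub-problem share the name (CONVENTIONS §1), as in every Theorems file
set_option linter.dupNamespace false

namespace Summit.NavierStokesRegularity.NavierStokesRegularity.Theorems.LocalTiltingFreeDoorKillingJets

open Set Function Filter Topology Metric
open scoped RealInnerProductSpace InnerProductSpace
open Literature.Analysis Literature.Analysis.FluidPDE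
open Summit.NavierStokesRegularity.NavierStokesRegularity.Theorems.LocalSineTubeDoorProfileAlignedWindowRigidityAncient
open Summit.NavierStokesRegularity.NavierStokesRegularity.Theorems.PoloidalWindowDoorPoloidalWindowRigidityLocalVorticitySymmetry (analyticOnNhd_curl_slice)
open Summit.NavierStokesRegularity.NavierStokesRegularity.Theorems.PoloidalWindowDoorPoloidalWindowRigiditySymmetryGerms (analyticOnNhd_fderiv_apply)
open Summit.NavierStokesRegularity.NavierStokesRegularity.Theorems.PoloidalWindowDoorPoloidalWindowRigidityKillingJetCompactness (exists_combination_eventuallyEq_zero)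
open Summit.NavierStokesRegularity.NavierStokesRegularity.Theorems.LocalTiltingFreeDoorSymmetricGerms
open Summit.NavierStokesRegularity.NavierStokesRegularity.Theorems.PlaneEnergyCeilingSlabEnergyIdentity (sum_smul_single_eq)

variable {C D : ℝ} {v : ℝ → EuclideanSpace ℝ (Fin 3) → EuclideanSpace ℝ (Fin 3)}

/-! ### The Euclidean algebra as a linear 6-parameter family -/

/-- The vector with prescribed coordinates: `(Σ pⱼ eⱼ) i = p i`. -/
theorem sum_smul_single_apply (p : Fin 3 → ℝ) (i : Fin 3) :
    (∑ j : Fin 3, p j • EuclideanSpace.single j (1 : ℝ)) i = p i := by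
  fin_cases i <;> simp [Fin.sum_univ_three]

/-- `Σⱼ bⱼ T eⱼ = T b` for a linear map `T`. -/
theorem sum_smul_apply_single (T : EuclideanSpace ℝ (Fin 3) →L[ℝ] EuclideanSpace ℝ (Fin 3)) (b : EuclideanSpace ℝ (Fin 3)) :
    ∑ j : Fin 3, b j • T (EuclideanSpace.single j (1 : ℝ)) = T b := by
  conv_rhs => rw [← sum_smul_single_eq b]
  rw [map_sum]
  exact Finset.sum_congr rfl fun j _ => by rw [map_smul]

/-- `Σⱼ aⱼ (eⱼ × w) = a × w`. -/
theorem sum_smul_cross_single (a w : EuclideanSpace ℝ (Fin 3)) :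
    ∑ j : Fin 3, a j • cross (EuclideanSpace.single j (1 : ℝ)) w = cross a w := by
  have h : ∀ x : EuclideanSpace ℝ (Fin 3), cross x w = (crossCLM.flip w) x := fun x => by
    rw [ContinuousLinearMap.flip_apply, crossCLM_apply]
  simp_rw [h]
  exact sum_smul_apply_single (crossCLM.flip w) a

/-- **The Lie derivative of a vector field along the Killing field `a × y + b` is linear in `(b, a) ∈ ℝ³ ⊕ ℝ³`**:
`Σⱼ bⱼ Dω(y)[eⱼ] + Σⱼ aⱼ (Dω(y)[eⱼ × y] − eⱼ × ω(y)) = Dω(y)[a × y + b] − a × ω(y)`. -/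
theorem lieDeriv_combination (ω : EuclideanSpace ℝ (Fin 3) → EuclideanSpace ℝ (Fin 3))
    (a b y : EuclideanSpace ℝ (Fin 3)) :
    (∑ i : Fin 3 ⊕ Fin 3, (Sum.elim (fun j => b j) (fun j => a j) i) •
        (Sum.elim (fun (j : Fin 3) (z : EuclideanSpace ℝ (Fin 3)) => fderiv ℝ ω z (EuclideanSpace.single j (1 : ℝ)))
          (fun (j : Fin 3) (z : EuclideanSpace ℝ (Fin 3)) =>
            fderiv ℝ ω z (cross (EuclideanSpace.single j (1 : ℝ)) z) - cross (EuclideanSpace.single j (1 : ℝ)) (ω z))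
          i) y) =
      fderiv ℝ ω y (cross a y + b) - cross a (ω y) := by
  rw [Fintype.sum_sum_type]
  simp only [Sum.elim_inl, Sum.elim_inr, smul_sub, Finset.sum_sub_distrib]
  have h1 : ∑ j : Fin 3, b j • fderiv ℝ ω y (EuclideanSpace.single j (1 : ℝ)) = fderiv ℝ ω y b :=
    sum_smul_apply_single (fderiv ℝ ω y) b
  have h2 : ∑ j : Fin 3, a j • fderiv ℝ ω y (cross (EuclideanSpace.single j (1 : ℝ)) y) = fderiv ℝ ω y (cross a y) := by
    rw [← sum_smul_cross_single a y, map_sum]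
    exact Finset.sum_congr rfl fun j _ => by rw [map_smul]
  rw [h1, h2, sum_smul_cross_single a (ω y), map_add]
  abel

/-! ### One point: all-orders Killing jets ⇒ a Killing germ -/

/-- **JET COMPACTNESS FOR THE EUCLIDEAN ALGEBRA.**  Let `ω` be real-analytic on `ℝ³`.  If for every order `N` there is a
Killing field `K(y) = a × y + b ≢ 0` with `Dⁿ(y ↦ Dω(y)[K y] − a × ω(y))(y₀) = 0` for all `n ≤ N` (the field may depend on
`N`), then ONE Killing field `≢ 0` has `Dω(y)[a × y + b] = a × ω(y)` for all `y` near `y₀`. -/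
theorem killingGerm_of_killing_jets {ω : EuclideanSpace ℝ (Fin 3) → EuclideanSpace ℝ (Fin 3)}
    {y₀ : EuclideanSpace ℝ (Fin 3)} (hω : AnalyticOnNhd ℝ ω univ)
    (hjet : ∀ N : ℕ, ∃ a b : EuclideanSpace ℝ (Fin 3), (a ≠ 0 ∨ b ≠ 0) ∧ ∀ n ≤ N,
      iteratedFDeriv ℝ n (fun y => fderiv ℝ ω y (cross a y + b) - cross a (ω y)) y₀ = 0) :
    ∃ a b : EuclideanSpace ℝ (Fin 3), (a ≠ 0 ∨ b ≠ 0) ∧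
      ∀ᶠ y in 𝓝 y₀, fderiv ℝ ω y (cross a y + b) = cross a (ω y) := by
  -- the six Lie-derivative fields of the Euclidean algebra
  set L : Fin 3 ⊕ Fin 3 → EuclideanSpace ℝ (Fin 3) → EuclideanSpace ℝ (Fin 3) :=
    Sum.elim (fun (j : Fin 3) (z : EuclideanSpace ℝ (Fin 3)) => fderiv ℝ ω z (EuclideanSpace.single j (1 : ℝ)))
      (fun (j : Fin 3) (z : EuclideanSpace ℝ (Fin 3)) =>
        fderiv ℝ ω z (cross (EuclideanSpace.single j (1 : ℝ)) z) - cross (EuclideanSpace.single j (1 : ℝ)) (ω z))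
    with hL
  have hLan : ∀ i, AnalyticOnNhd ℝ (L i) univ := by
    rintro (j | j)
    · simp only [hL, Sum.elim_inl]
      exact analyticOnNhd_fderiv_apply hω analyticOnNhd_const
    · simp only [hL, Sum.elim_inr]
      refine (analyticOnNhd_fderiv_apply hω fun z _ => ?_).sub fun z _ => ?_
      · exact (crossCLM (EuclideanSpace.single j (1 : ℝ))).analyticAt z
      · exact ((crossCLM (EuclideanSpace.single j (1 : ℝ))).analyticAt (ω z)).comp (hω z (mem_univ z))
  have hcombo : ∀ (a b y : EuclideanSpace ℝ (Fin 3)),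
      (∑ i, (Sum.elim (fun j => b j) (fun j => a j) i) • L i y) = fderiv ℝ ω y (cross a y + b) - cross a (ω y) :=
    fun a b y => by rw [hL]; exact lieDeriv_combination ω a b y
  -- the jet hypothesis in the linear-family form
  have hjet' : ∀ N : ℕ, ∃ p : Fin 3 ⊕ Fin 3 → ℝ, p ≠ 0 ∧ ∀ n ≤ N, ∑ i, p i • iteratedFDeriv ℝ n (L i) y₀ = 0 := by
    intro N
    obtain ⟨a, b, hab, hN⟩ := hjet N
    refine ⟨Sum.elim (fun j => b j) (fun j => a j), fun hp => ?_, fun n hn => ?_⟩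
    · have hb : b = 0 := by
        rw [← sum_smul_single_eq b]
        refine Finset.sum_eq_zero fun j _ => ?_
        have h0 : Sum.elim (fun j => b j) (fun j => a j) (Sum.inl j) = 0 := by rw [hp]; rfl
        rw [Sum.elim_inl] at h0
        rw [h0, zero_smul]
      have ha : a = 0 := by
        rw [← sum_smul_single_eq a]
        refine Finset.sum_eq_zero fun j _ => ?_
        have h0 : Sum.elim (fun j => b j) (fun j => a j) (Sum.inr j) = 0 := by rw [hp]; rfl
        rw [Sum.elim_inr] at h0
        rw [h0, zero_smul]
      rcases hab with h | h
      · exact h ha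
      · exact h hb
    · have hcd : ∀ i ∈ (Finset.univ : Finset (Fin 3 ⊕ Fin 3)),
          ContDiffAt ℝ n (fun y => (Sum.elim (fun j => b j) (fun j => a j) i) • L i y) y₀ := fun i _ =>
        (contDiffAt_const (c := Sum.elim (fun j => b j) (fun j => a j) i)).smul
          ((hLan i y₀ (mem_univ _)).contDiffAt (n := n))
      have e1 : iteratedFDeriv ℝ n (fun y => ∑ i, (Sum.elim (fun j => b j) (fun j => a j) i) • L i y) y₀ =
          ∑ i, (Sum.elim (fun j => b j) (fun j => a j) i) • iteratedFDeriv ℝ n (L i) y₀ := by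
        rw [iteratedFDeriv_fun_sum_apply hcd]
        exact Finset.sum_congr rfl fun i _ =>
          iteratedFDeriv_const_smul_apply' ((hLan i y₀ (mem_univ _)).contDiffAt (n := n))
      rw [← e1, show (fun y => ∑ i, (Sum.elim (fun j => b j) (fun j => a j) i) • L i y) =
        fun y => fderiv ℝ ω y (cross a y + b) - cross a (ω y) from funext (hcombo a b)]
      exact hN n hn
  obtain ⟨p, hp0, hev⟩ := exists_combination_eventuallyEq_zero L y₀ (fun i => hLan i y₀ (mem_univ _)) hjet'
  -- back to a Killing field
  set a : EuclideanSpace ℝ (Fin 3) := ∑ j : Fin 3, p (Sum.inr j) • EuclideanSpace.single j (1 : ℝ) with ha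
  set b : EuclideanSpace ℝ (Fin 3) := ∑ j : Fin 3, p (Sum.inl j) • EuclideanSpace.single j (1 : ℝ) with hb
  have hpab : Sum.elim (fun j => b j) (fun j => a j) = p := by
    funext i
    rcases i with j | j
    · rw [Sum.elim_inl, hb, sum_smul_single_apply]
    · rw [Sum.elim_inr, ha, sum_smul_single_apply]
  refine ⟨a, b, ?_, ?_⟩
  · by_contra hne
    push Not at hne
    obtain ⟨ha0, hb0⟩ := hne
    apply hp0
    rw [← hpab]
    funext i
    rcases i with j | j
    · rw [Sum.elim_inl, hb0]; rfl
    · rw [Sum.elim_inr, ha0]; rfl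
  · filter_upwards [hev] with y hy
    have hy' : ∑ i, p i • L i y = 0 := hy
    rw [← hpab, hcombo a b y] at hy'
    exact sub_eq_zero.1 hy'

/-! ### One slice: the TSG window conclusion from pointwise jets at a dense set of points -/

/-- **TSG on one slice from its pointwise jet form.**  Let `s < 0` be a slice of a profile of the Type-I class (so
`curl v(s)` is real-analytic).  If every nonempty open window on which `curl v(s) ≠ 0` contains a point `y₀` at which
EITHER Killing jets of all orders exist (for every `N` some `a × y + b ≢ 0` kills the `N`-jet of
`Dω[a × · + b] − a × ω` at `y₀`) OR `v(s)` agrees near `y₀` with an entire real-analytic field of unbounded norm, then the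
conclusion of TSG holds on the slice: every such window contains a nonempty open `U` carrying a Killing germ of the
vorticity (`c = 0`) or an unbounded entire germ of the velocity. -/
theorem tsgWindow_of_pointwise (hrate : HasTypeITimeDecay C v)
    (hcont : ContinuousOn (uncurry v) (Iio (0 : ℝ) ×ˢ univ))
    (hmild : ∀ s t : ℝ, s < t → t < 0 → ∀ x,
      v t x = UnboundedOperators.heatExtension (v s) (t - s) x - oseenDuhamel 1 s v v t x)
    {s : ℝ} (hs : s < 0)
    (hpt : ∀ W : Set (EuclideanSpace ℝ (Fin 3)), IsOpen W → W.Nonempty → (∀ y ∈ W, curl (v s) y ≠ 0) →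
      ∃ y₀ ∈ W, ((∀ N : ℕ, ∃ a b : EuclideanSpace ℝ (Fin 3), (a ≠ 0 ∨ b ≠ 0) ∧ ∀ n ≤ N,
        iteratedFDeriv ℝ n (fun y => fderiv ℝ (curl (v s)) y (cross a y + b) - cross a (curl (v s) y)) y₀ = 0) ∨
        (∃ w : EuclideanSpace ℝ (Fin 3) → EuclideanSpace ℝ (Fin 3), AnalyticOnNhd ℝ w Set.univ ∧
          ¬ BddAbove (Set.range fun y => ‖w y‖) ∧ ∀ᶠ y in 𝓝 y₀, v s y = w y))) :
    ∀ W : Set (EuclideanSpace ℝ (Fin 3)), IsOpen W → W.Nonempty → (∀ y ∈ W, curl (v s) y ≠ 0) →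
      ∃ U : Set (EuclideanSpace ℝ (Fin 3)), IsOpen U ∧ U.Nonempty ∧ U ⊆ W ∧
        ((∃ a b c : EuclideanSpace ℝ (Fin 3), (a ≠ 0 ∨ b ≠ 0) ∧ ∀ y ∈ U,
            (fderiv ℝ (curl (v s)) y (cross a (y - c) + b) = cross a (curl (v s) y))) ∨
          (∃ w : EuclideanSpace ℝ (Fin 3) → EuclideanSpace ℝ (Fin 3), AnalyticOnNhd ℝ w Set.univ ∧
            ¬ BddAbove (Set.range fun y => ‖w y‖) ∧ ∀ y ∈ U, v s y = w y)) := by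
  intro W hW hWne hcurl
  have hω : AnalyticOnNhd ℝ (curl (v s)) univ := analyticOnNhd_curl_slice hrate hcont hmild hs
  obtain ⟨y₀, hy₀, hbranch⟩ := hpt W hW hWne hcurl
  rcases hbranch with hjet | ⟨w, hw, hunb, hev⟩
  · obtain ⟨a, b, hab, hev⟩ := killingGerm_of_killing_jets hω hjet
    obtain ⟨ε, hε, hball⟩ := Metric.eventually_nhds_iff_ball.1 hev
    refine ⟨W ∩ Metric.ball y₀ ε, hW.inter Metric.isOpen_ball, ⟨y₀, hy₀, Metric.mem_ball_self hε⟩,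
      inter_subset_left, Or.inl ⟨a, b, 0, hab, fun y hy => ?_⟩⟩
    rw [sub_zero]
    exact hball y hy.2
  · obtain ⟨ε, hε, hball⟩ := Metric.eventually_nhds_iff_ball.1 hev
    exact ⟨W ∩ Metric.ball y₀ ε, hW.inter Metric.isOpen_ball, ⟨y₀, hy₀, Metric.mem_ball_self hε⟩,
      inter_subset_left, Or.inr ⟨w, hw, hunb, fun y hy => hball y hy.2⟩⟩

/-! ### TSG, K2 and the door from the pointwise jet statement (quantified over the class) -/

/-- **TSG (text of nsreg-p1 `r18/TiltingSymmetryGerm_line.lean` `stub_tiltingSymmetryGerm`, verbatim) FROM ITS POINTWISE-DENSE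
JET FORM**: if for every tilting-free door-class profile, on every slice, every nonempty open window where the vorticity
does not vanish contains a point carrying Killing jets of all orders or an unbounded entire germ of the velocity, then TSG
holds.  The hypothesis is the statement a jet census of NS ∧ `{ω × Sω = 0}` delivers at generic points; it is NOT assumed
anywhere in the tree. -/
theorem tiltingSymmetryGerm_of_pointwiseKillingJets
    (h : ∀ (C D : ℝ) (v : ℝ → EuclideanSpace ℝ (Fin 3) → EuclideanSpace ℝ (Fin 3)), Literature.Analysis.FluidPDE.HasTypeITimeDecay C v → Literature.Analysis.FluidPDE.HasTypeIDecay D v → ContinuousOn (Function.uncurry v) (Set.Iio (0 : ℝ) ×ˢ Set.univ) → (∀ s t : ℝ, s < t → t < 0 → ∀ x, v t x = Literature.Analysis.UnboundedOperators.heatExtension (v s) (t - s) x - Literature.Analysis.FluidPDE.oseenDuhamel 1 s v v t x) → (∀ t < 0, Literature.Analysis.FluidPDE.VectorCalculus.IsDivFree (v t)) → (∀ s < 0, ∀ z : EuclideanSpace ℝ (Fin 3), Literature.Analysis.FluidPDE.cross (Literature.Analysis.FluidPDE.curlCLM (fderiv ℝ (v s) z)) ((fderiv ℝ (v s) z) (Literature.Analysis.FluidPDE.curlCLM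 (fderiv ℝ (v s) z))) = 0) → ∀ s < 0, ∀ W : Set (EuclideanSpace ℝ (Fin 3)), IsOpen W → W.Nonempty → (∀ y ∈ W, Literature.Analysis.FluidPDE.curl (v s) y ≠ 0) → ∃ y₀ ∈ W, ((∀ N : ℕ, ∃ a b : EuclideanSpace ℝ (Fin 3), (a ≠ 0 ∨ b ≠ 0) ∧ ∀ n ≤ N, iteratedFDeriv ℝ n (fun y => fderiv ℝ (Literature.Analysis.FluidPDE.curl (v s)) y (Literature.Analysis.FluidPDE.cross a y + b) - Literature.Analysis.FluidPDE.cross a (Literature.Analysis.FluidPDE.curl (v s) y)) y₀ = 0) ∨ (∃ w : EuclideanSpace ℝ (Fin 3) → EuclideanSpace ℝ (Fin 3), AnalyticOnNhd ℝ w Set.univ ∧ ¬ BddAbove (Set.range fun y => ‖w y‖) ∧ ∀ᶠ y in nhds y₀, v s y = w y))) :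
    ∀ (C D : ℝ) (v : ℝ → EuclideanSpace ℝ (Fin 3) → EuclideanSpace ℝ (Fin 3)), Literature.Analysis.FluidPDE.HasTypeITimeDecay C v → Literature.Analysis.FluidPDE.HasTypeIDecay D v → ContinuousOn (Function.uncurry v) (Set.Iio (0 : ℝ) ×ˢ Set.univ) → (∀ s t : ℝ, s < t → t < 0 → ∀ x, v t x = Literature.Analysis.UnboundedOperators.heatExtension (v s) (t - s) x - Literature.Analysis.FluidPDE.oseenDuhamel 1 s v v t x) → (∀ t < 0, Literature.Analysis.FluidPDE.VectorCalculus.IsDivFree (v t)) → (∀ s < 0, ∀ z : EuclideanSpace ℝ (Fin 3), Literature.Analysis.FluidPDE.cross (Literature.Analysis.FluidPDE.curlCLM (fderiv ℝ (v s) z)) ((fderiv ℝ (v s) z) (Literature.Analysis.FluidPDE.curlCLM (fderiv ℝ (v s) z))) = 0) → (∀ s < 0, ∀ W : Set (EuclideanSpace ℝ (Fin 3)), IsOpen W → W.Nonempty → (∀ y ∈ W, Literature.Analysis.FluidPDE.curl (v s) y ≠ 0) → ∃ U : Set (EuclideanSpace ℝ (Fin 3)), IsOpen U ∧ U.Nonempty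 ∧ U ⊆ W ∧ ((∃ a b c : EuclideanSpace ℝ (Fin 3), (a ≠ 0 ∨ b ≠ 0) ∧ ∀ y ∈ U, (fderiv ℝ (Literature.Analysis.FluidPDE.curl (v s)) y (Literature.Analysis.FluidPDE.cross a (y - c) + b) = Literature.Analysis.FluidPDE.cross a (Literature.Analysis.FluidPDE.curl (v s) y))) ∨ (∃ w : EuclideanSpace ℝ (Fin 3) → EuclideanSpace ℝ (Fin 3), AnalyticOnNhd ℝ w Set.univ ∧ ¬ BddAbove (Set.range fun y => ‖w y‖) ∧ ∀ y ∈ U, v s y = w y))) := by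
  intro C D v hrate hdec hcont hmild hdiv htilt s hs W hW hWne hcurl
  exact tsgWindow_of_pointwise hrate hcont hmild hs (h C D v hrate hdec hcont hmild hdiv htilt s hs) W hW hWne hcurl

/-- **K2 `TiltingFreeProfileRigidity` (text verbatim) from the pointwise jet statement alone**
(`…SymmetricGerms.tiltingFreeProfileRigidity_of_tiltingSymmetryGerm` ∘ `tiltingSymmetryGerm_of_pointwiseKillingJets`). -/
theorem tiltingFreeProfileRigidity_of_pointwiseKillingJets
    (h : ∀ (C D : ℝ) (v : ℝ → EuclideanSpace ℝ (Fin 3) → EuclideanSpace ℝ (Fin 3)), Literature.Analysis.FluidPDE.HasTypeITimeDecay C v → Literature.Analysis.FluidPDE.HasTypeIDecay D v → ContinuousOn (Function.uncurry v) (Set.Iio (0 : ℝ) ×ˢ Set.univ) → (∀ s t : ℝ, s < t → t < 0 → ∀ x, v t x = Literature.Analysis.UnboundedOperators.heatExtension (v s) (t - s) x - Literature.Analysis.FluidPDE.oseenDuhamel 1 s v v t x) → (∀ t < 0, Literature.Analysis.FluidPDE.VectorCalculus.IsDivFree (v t)) → (∀ s < 0, ∀ z : EuclideanSpace ℝ (Fin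 3), Literature.Analysis.FluidPDE.cross (Literature.Analysis.FluidPDE.curlCLM (fderiv ℝ (v s) z)) ((fderiv ℝ (v s) z) (Literature.Analysis.FluidPDE.curlCLM (fderiv ℝ (v s) z))) = 0) → ∀ s < 0, ∀ W : Set (EuclideanSpace ℝ (Fin 3)), IsOpen W → W.Nonempty → (∀ y ∈ W, Literature.Analysis.FluidPDE.curl (v s) y ≠ 0) → ∃ y₀ ∈ W, ((∀ N : ℕ, ∃ a b : EuclideanSpace ℝ (Fin 3), (a ≠ 0 ∨ b ≠ 0) ∧ ∀ n ≤ N, iteratedFDeriv ℝ n (fun y => fderiv ℝ (Literature.Analysis.FluidPDE.curl (v s)) y (Literature.Analysis.FluidPDE.cross a y + b) - Literature.Analysis.FluidPDE.cross a (Literature.Analysis.FluidPDE.curl (v s) y)) y₀ = 0) ∨ (∃ w : EuclideanSpace ℝ (Fin 3) → EuclideanSpace ℝ (Fin 3), AnalyticOnNhd ℝ w Set.univ ∧ ¬ BddAbove (Set.range fun y => ‖w y‖) ∧ ∀ᶠ y in nhds y₀, v s y = w y))) :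
    ∀ (C D : ℝ) (v : ℝ → EuclideanSpace ℝ (Fin 3) → EuclideanSpace ℝ (Fin 3)), Literature.Analysis.FluidPDE.HasTypeITimeDecay C v → Literature.Analysis.FluidPDE.HasTypeIDecay D v → ContinuousOn (Function.uncurry v) (Set.Iio (0 : ℝ) ×ˢ Set.univ) → (∀ s t : ℝ, s < t → t < 0 → ∀ x, v t x = Literature.Analysis.UnboundedOperators.heatExtension (v s) (t - s) x - Literature.Analysis.FluidPDE.oseenDuhamel 1 s v v t x) → (∀ t < 0, Literature.Analysis.FluidPDE.VectorCalculus.IsDivFree (v t)) → (∀ s < 0, ∃ U : Set (EuclideanSpace ℝ (Fin 3)), IsOpen U ∧ U.Nonempty ∧ ∀ z ∈ U, Literature.Analysis.FluidPDE.cross (Literature.Analysis.FluidPDE.curlCLM (fderiv ℝ (v s) z)) ((fderiv ℝ (v s) z) (Literature.Analysis.FluidPDE.curlCLM (fderiv ℝ (v s) z))) = 0) → ¬ Literature.Analysis.FluidPDE.IsBackwardSingularPoint v 0 :=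
  tiltingFreeProfileRigidity_of_tiltingSymmetryGerm (tiltingSymmetryGerm_of_pointwiseKillingJets h)

/-- **The door `Target` of S19 (text verbatim) from the pointwise jet statement alone**
(`…SymmetricGerms.target_of_tiltingSymmetryGerm` ∘ `tiltingSymmetryGerm_of_pointwiseKillingJets`). -/
theorem target_of_pointwiseKillingJets
    (h : ∀ (C D : ℝ) (v : ℝ → EuclideanSpace ℝ (Fin 3) → EuclideanSpace ℝ (Fin 3)), Literature.Analysis.FluidPDE.HasTypeITimeDecay C v → Literature.Analysis.FluidPDE.HasTypeIDecay D v → ContinuousOn (Function.uncurry v) (Set.Iio (0 : ℝ) ×ˢ Set.univ) → (∀ s t : ℝ, s < t → t < 0 → ∀ x, v t x = Literature.Analysis.UnboundedOperators.heatExtension (v s) (t - s) x - Literature.Analysis.FluidPDE.oseenDuhamel 1 s v v t x) → (∀ t < 0, Literature.Analysis.FluidPDE.VectorCalculus.IsDivFree (v t)) → (∀ s < 0, ∀ z : EuclideanSpace ℝ (Fin 3), Literature.Analysis.FluidPDE.cross (Literature.Analysis.FluidPDE.curlCLM (fderiv ℝ (v s) z)) ((fderiv ℝ (v s) z) (Literature.Analysis.FluidPDE.curlCLM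 (fderiv ℝ (v s) z))) = 0) → ∀ s < 0, ∀ W : Set (EuclideanSpace ℝ (Fin 3)), IsOpen W → W.Nonempty → (∀ y ∈ W, Literature.Analysis.FluidPDE.curl (v s) y ≠ 0) → ∃ y₀ ∈ W, ((∀ N : ℕ, ∃ a b : EuclideanSpace ℝ (Fin 3), (a ≠ 0 ∨ b ≠ 0) ∧ ∀ n ≤ N, iteratedFDeriv ℝ n (fun y => fderiv ℝ (Literature.Analysis.FluidPDE.curl (v s)) y (Literature.Analysis.FluidPDE.cross a y + b) - Literature.Analysis.FluidPDE.cross a (Literature.Analysis.FluidPDE.curl (v s) y)) y₀ = 0) ∨ (∃ w : EuclideanSpace ℝ (Fin 3) → EuclideanSpace ℝ (Fin 3), AnalyticOnNhd ℝ w Set.univ ∧ ¬ BddAbove (Set.range fun y => ‖w y‖) ∧ ∀ᶠ y in nhds y₀, v s y = w y))) :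
    ∀ (ν T : ℝ), 0 < ν → 0 < T → ∀ (u : ℝ → EuclideanSpace ℝ (Fin 3) → EuclideanSpace ℝ (Fin 3)) (p : ℝ → EuclideanSpace ℝ (Fin 3) → ℝ), Literature.Analysis.FluidPDE.IsClassicalNSSolutionOn (Set.Ico 0 T) ν 0 u p → Literature.Analysis.FluidPDE.IsLerayHopfOn T ν 0 (u 0) u → Literature.Analysis.FluidPDE.HasRapidSpatialDecay (u 0) → ∀ (x₀ : EuclideanSpace ℝ (Fin 3)) (ρ M : ℝ), 0 < ρ → (∀ t ∈ Set.Ico 0 T, T - ρ ^ 2 < t → ∀ x ∈ Metric.ball x₀ ρ, ‖u t x‖ * (‖x - x₀‖ + Real.sqrt (ν * (T - t))) ≤ M) → ∀ (U : Set (EuclideanSpace ℝ (Fin 3))), IsOpen U → U.Nonempty → Filter.Tendsto (fun t => ∫⁻ y in U, ENNReal.ofReal ‖Literature.Analysis.FluidPDE.cross (Literature.Analysis.FluidPDE.curlCLM (Real.sqrt (T - t) ^ 2 • fderiv ℝ (u t) (x₀ + Real.sqrt (T - t) • y))) ((Real.sqrt (T - t) ^ 2 • fderiv ℝ (u t) (x₀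 + Real.sqrt (T - t) • y)) (Literature.Analysis.FluidPDE.curlCLM (Real.sqrt (T - t) ^ 2 • fderiv ℝ (u t) (x₀ + Real.sqrt (T - t) • y))))‖) (nhdsWithin T (Set.Iio T)) (nhds 0) → Literature.Analysis.FluidPDE.IsBackwardBoundedAt u T x₀ :=
  target_of_tiltingSymmetryGerm (tiltingSymmetryGerm_of_pointwiseKillingJets h)

end Summit.NavierStokesRegularity.NavierStokesRegularity.Theorems.LocalTiltingFreeDoorKillingJets

end
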